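import Mathlib
import Literature.NumberTheory.Transcendental.PeriodsWave0
import HarnessLib

/-!
# Nesterenko's linear independence criterion for vectors (Fischler 2015) and the rank of
# `(ζ(i), C(i+1,2)ζ(i+2))`

Topic `Literature/NumberTheory/Irrationality/Fischler2015`. Typed, cited statements (no proofs) from S. Fischler,
*Nesterenko's linear independence criterion for vectors*, Monatsh. Math. **177**:3 (2015) 397–419 = arXiv:1202.2279
[Fischler2015Vectors]. READ ON THE PAGE (held text `paper:arxiv-1202.2279`, §1 = chunks p0003–p0004, §2 = p0006;
arXiv numbering):

* "**Theorem 1.** In `ℝ²` seen as a `ℚ`-vector space, the family of vectors `(1,0)`, `(0,1)`, `(ζ(3), 6ζ(5))`,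
  `(ζ(5), 15ζ(7))`, …, `(ζ(a), a(a+1)/2 · ζ(a+2))` has rank greater than or equal to `(2 log a/(1+log 2))(1+o(1))`
  as `a → ∞`, with `a` odd." (`a(a+1)/2 = C(a+1, 2)`) — `theorem1`; "a strict improvement upon" Ball–Rivoal
  (tree `Literature.NumberTheory.Transcendental.ball_rivoal`).
* "**Corollary 1.** Let `a ≥ 3` be an odd integer. Denote by `n₁(a)` the number of odd integers `i ∈ {3,5,…,a}` such
  that `ζ(i) ∉ ℚ`, and by `n₂(a)` the number of odd integers `j ∈ {5,7,…,a}` such that `ζ(j) ∉ ℚ` and `ζ(j−2) ∈ ℚ`.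
  Then we have `n₁(a) + n₂(a) ≥ (2 log a/(1+log 2))(1+o(1))` as `a → ∞`." — `corollary1`.
* "**Theorem 2.** Let `λ ∈ ℝ`. When `a` is odd and `a → ∞`, the dimension of the `ℚ`-vector space spanned by the
  numbers `1, λ, ζ(3) + 6λζ(5), ζ(5) + 15λζ(7), …, ζ(a) + C(a+1,2)λζ(a+2)` is greater than or equal to
  `(log a/(1+log 2))(1+o(1))`." — `theorem2`.
* "**Theorem 3.**" (the criterion; parts (i) and (ii) typed, the quantitative (iii) NOT typed) — `theorem3`:
  `1 ≤ k ≤ p−1`, `e_1, …, e_k ∈ ℝ^p`; `τ_1, …, τ_k > 0` pairwise distinct; `ω_j, φ_j` real with infinitely many `n`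
  such that `nω_j + φ_j ≢ π/2 mod π` for all `j`; `(Q_n)` an increasing sequence of positive integers with
  `Q_{n+1} = Q_n^{1+O(1/n)}` (or only `Q_n^{1+o(1)}` if all `ω_j = 0`); integer linear forms
  `L_n = Σ ℓ_{i,n} X_i` with `|L_n(e_j)| = Q_n^{−τ_j+o(1)}|cos(nω_j+φ_j)+o(1)|` and `max_i |ℓ_{i,n}| ≤ Q_n^{1+o(1)}`.
  Then (i) `rk_ℚ(C_1, …, C_p) ≥ k + τ_1 + ⋯ + τ_k` for the columns `C_i ∈ ℝ^k` of the matrix with rows `e_j`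
  ("in other words" form of (i)), and (ii) the `e_j` are `ℝ`-linearly independent and their `ℝ`-span meets `ℚ^p`
  only in `0`.

Rendering of the asymptotic hypotheses: each `o(1)` is an explicit sequence tending to `0` (one pair `ε_j, δ_j` per
point `e_j`, one `η` for the heights), the equalities holding for all large `n`; "increasing" is typed `StrictMono`
(with a constant `Q_n` the statement would be false — and the paper's `Q_{n+1} > Q_n` usage, §1 "`Q_n ≤ Q < Q_{n+1}`",
is strict); `Q_{n+1} = Q_n^{1+O(1/n)}` as `Q_{n+1} ≤ Q_n^{1+C/n}` (`n ≥ 1`; the lower inequality is automatic for an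
increasing sequence). `(1+o(1))` lower bounds are typed as "`≥ (1−ε)·(main term)` for every `ε > 0` and all large
odd `a`". `ζ(k) = zetaValue k` (tree, `PeriodsWave0`).

NOT typed: Theorem 3 (iii) and Theorem 4/Corollaries 2–3 (column reformulations), Theorem 5 (Siegel-type
criterion), §4 (the forms `S_n`, `S_n''`). WHAT THIS IS NOT: nothing isolates `ζ(5)`; a criterion + record file
for cell zeta5-irr (forms small at several points).
-/

noncomputable section

open Filter Topology Finset

namespace Literature.NumberTheory.Irrationality.Fischler2015

open Literature.NumberTheory.Transcendental (zetaValue)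

/-! ## §1 — zeta values -/

/-- The vectors `(ζ(i), C(i+1,2) ζ(i+2)) ∈ ℝ²` of Theorem 1 (`C(4,2) = 6`, `C(6,2) = 15`, …, `C(a+1,2) = a(a+1)/2`).
[cite: Fischler2015Vectors, Theorem 1] -/
def zetaPair (i : ℕ) : ℝ × ℝ := (zetaValue i, (Nat.choose (i + 1) 2 : ℝ) * zetaValue (i + 2))

/-- **Theorem 1** (Fischler 2015): the rank over `ℚ` of `(1,0), (0,1), (ζ(3),6ζ(5)), (ζ(5),15ζ(7)), …,
(ζ(a), C(a+1,2)ζ(a+2))` in `ℝ²` is `≥ (2 log a/(1+log 2))(1+o(1))` (`a → ∞` odd). Named fact (statement only).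
[cite: Fischler2015Vectors, Theorem 1] -/
def theorem1 : Prop :=
  ∀ ε : ℝ, 0 < ε → ∀ᶠ a : ℕ in atTop, Odd a →
    (1 - ε) * (2 * Real.log a / (1 + Real.log 2)) ≤
      Module.finrank ℚ
        ↥(Submodule.span ℚ
          ({((1 : ℝ), (0 : ℝ)), ((0 : ℝ), (1 : ℝ))} ∪
            {v : ℝ × ℝ | ∃ i : ℕ, Odd i ∧ 3 ≤ i ∧ i ≤ a ∧ v = zetaPair i}))

/-- `n₁(a)`: the number of odd `i ∈ {3, 5, …, a}` with `ζ(i) ∉ ℚ`. [cite: Fischler2015Vectors, Corollary 1] -/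
def nOne (a : ℕ) : ℕ := Set.ncard {i : ℕ | Odd i ∧ 3 ≤ i ∧ i ≤ a ∧ Irrational (zetaValue i)}

/-- `n₂(a)`: the number of odd `j ∈ {5, 7, …, a}` with `ζ(j) ∉ ℚ` and `ζ(j−2) ∈ ℚ` (essentially the number of
blocks of consecutive irrational odd zeta values). [cite: Fischler2015Vectors, Corollary 1] -/
def nTwo (a : ℕ) : ℕ :=
  Set.ncard {j : ℕ | Odd j ∧ 5 ≤ j ∧ j ≤ a ∧ Irrational (zetaValue j) ∧ ¬ Irrational (zetaValue (j - 2))}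

/-- **Corollary 1** (Fischler 2015): `n₁(a) + n₂(a) ≥ (2 log a/(1+log 2))(1+o(1))` as `a → ∞` (odd `a`).
Named fact (statement only). [cite: Fischler2015Vectors, Corollary 1] -/
def corollary1 : Prop :=
  ∀ ε : ℝ, 0 < ε → ∀ᶠ a : ℕ in atTop, Odd a →
    (1 - ε) * (2 * Real.log a / (1 + Real.log 2)) ≤ (nOne a : ℝ) + nTwo a

/-- **Theorem 2** (Fischler 2015): for every real `λ`, the `ℚ`-span of
`1, λ, ζ(3) + 6λζ(5), ζ(5) + 15λζ(7), …, ζ(a) + C(a+1,2)λζ(a+2)` has dimension `≥ (log a/(1+log 2))(1+o(1))`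
(`a → ∞` odd). Named fact (statement only). [cite: Fischler2015Vectors, Theorem 2] -/
def theorem2 : Prop :=
  ∀ (l ε : ℝ), 0 < ε → ∀ᶠ a : ℕ in atTop, Odd a →
    (1 - ε) * (Real.log a / (1 + Real.log 2)) ≤
      Module.finrank ℚ
        ↥(Submodule.span ℚ
          ({(1 : ℝ), l} ∪
            {x : ℝ | ∃ i : ℕ, Odd i ∧ 3 ≤ i ∧ i ≤ a ∧
              x = zetaValue i + (Nat.choose (i + 1) 2 : ℝ) * l * zetaValue (i + 2)}))

/-! ## Theorem 3 — the criterion for vectors (parts (i), (ii)) -/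

/-- The growth condition on `(Q_n)`: `Q_{n+1} = Q_n^{1+O(1/n)}`, or only `Q_{n+1} = Q_n^{1+o(1)}` when all the
frequencies `ω_j` vanish. [cite: Fischler2015Vectors, Theorem 3 (hypothesis on Q_n)] -/
def GrowthCondition {k : ℕ} (ω : Fin k → ℝ) (Q : ℕ → ℕ) : Prop :=
  (∃ C : ℝ, ∀ n : ℕ, 1 ≤ n → (Q (n + 1) : ℝ) ≤ (Q n : ℝ) ^ (1 + C / n)) ∨
    ((∀ j, ω j = 0) ∧ ∃ η : ℕ → ℝ, Tendsto η atTop (𝓝 0) ∧ ∀ n : ℕ, (Q (n + 1) : ℝ) ≤ (Q n : ℝ) ^ (1 + η n))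

/-- The smallness hypothesis at the point `e_j`: `|L_n(e_j)| = Q_n^{−τ_j+o(1)} |cos(nω_j + φ_j) + o(1)|`
(`L_n = Σ_i ℓ_{i,n} X_i`), the two `o(1)` being explicit null sequences.
[cite: Fischler2015Vectors, Theorem 3 eq. (1.4)] -/
def SmallAt {p : ℕ} (ℓ : ℕ → Fin p → ℤ) (Q : ℕ → ℕ) (e : Fin p → ℝ) (τ ω φ : ℝ) : Prop :=
  ∃ ε δ : ℕ → ℝ, Tendsto ε atTop (𝓝 0) ∧ Tendsto δ atTop (𝓝 0) ∧
    ∀ᶠ n : ℕ in atTop,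
      |∑ i, (ℓ n i : ℝ) * e i| = (Q n : ℝ) ^ (-τ + ε n) * |Real.cos (n * ω + φ) + δ n|

/-- The height hypothesis: `max_i |ℓ_{i,n}| ≤ Q_n^{1+o(1)}`. [cite: Fischler2015Vectors, Theorem 3] -/
def HeightBound {p : ℕ} (ℓ : ℕ → Fin p → ℤ) (Q : ℕ → ℕ) : Prop :=
  ∃ η : ℕ → ℝ, Tendsto η atTop (𝓝 0) ∧ ∀ᶠ n : ℕ in atTop, ∀ i, |(ℓ n i : ℝ)| ≤ (Q n : ℝ) ^ (1 + η n)

/-- **Theorem 3 (i), (ii)** (Fischler 2015; Nesterenko's criterion for vectors). Data: `1 ≤ k ≤ p − 1`, points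
`e_1, …, e_k ∈ ℝ^p`, pairwise distinct `τ_j > 0`, phases with `nω_j + φ_j ≢ π/2 (mod π)` for all `j` and
infinitely many `n`, a (strictly) increasing sequence of positive integers `Q_n` with the growth condition, integer
linear forms `L_n` small at every `e_j` and of height `≤ Q_n^{1+o(1)}`. Then (i) the columns `C_1, …, C_p ∈ ℝ^k` of
the matrix with rows `e_1, …, e_k` satisfy `rk_ℚ(C_1,…,C_p) ≥ k + τ_1 + ⋯ + τ_k`; (ii) `e_1, …, e_k` are
`ℝ`-linearly independent and `Span_ℝ(e_1,…,e_k) ∩ ℚ^p = {0}`. Named fact (statement only; (iii) not typed).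
[cite: Fischler2015Vectors, Theorem 3 (i)–(ii)] -/
def theorem3 : Prop :=
  ∀ (p k : ℕ) (e : Fin k → Fin p → ℝ) (τ ω φ : Fin k → ℝ) (Q : ℕ → ℕ) (ℓ : ℕ → Fin p → ℤ),
    1 ≤ k → k + 1 ≤ p →
    (∀ j, 0 < τ j) → Function.Injective τ →
    {n : ℕ | ∀ j, ∀ m : ℤ, (n : ℝ) * ω j + φ j ≠ Real.pi / 2 + m * Real.pi}.Infinite →
    StrictMono Q → (∀ n, 0 < Q n) → GrowthCondition ω Q →
    (∀ j, SmallAt ℓ Q (e j) (τ j) (ω j) (φ j)) → HeightBound ℓ Q →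
      (k : ℝ) + ∑ j, τ j ≤
          Module.finrank ℚ ↥(Submodule.span ℚ (Set.range fun i : Fin p => fun j : Fin k => e j i)) ∧
        LinearIndependent ℝ e ∧
          ∀ v ∈ Submodule.span ℝ (Set.range e), (∃ q : Fin p → ℚ, v = fun i => (q i : ℝ)) → v = 0

/-- Sanity: with one point (`k = 1`), no oscillation (`ω = φ = 0`) the smallness hypothesis of Theorem 3 is
Nesterenko's `|L_n(e)| = Q_n^{−τ+o(1)}(1+o(1))`: `cos(0) + δ_n = 1 + δ_n`.
[cite: Fischler2015Vectors, §1 ("If k = 1 and ω₁ = φ₁ = 0, this is exactly Nesterenko's linear independence criterion")] -/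
theorem smallAt_zero_iff {p : ℕ} (ℓ : ℕ → Fin p → ℤ) (Q : ℕ → ℕ) (e : Fin p → ℝ) (τ : ℝ) :
    SmallAt ℓ Q e τ 0 0 ↔ ∃ ε δ : ℕ → ℝ, Tendsto ε atTop (𝓝 0) ∧ Tendsto δ atTop (𝓝 0) ∧
      ∀ᶠ n : ℕ in atTop, |∑ i, (ℓ n i : ℝ) * e i| = (Q n : ℝ) ^ (-τ + ε n) * |1 + δ n| := by
  simp [SmallAt]

/-! ## Theorem 1 implies Ball–Rivoal's bound (§1: "It is clear that Theorem 1 implies Eq. (1.1)") -/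

/-- "If `E` is a `ℚ`-subspace of `ℝ` which contains `1, ζ(3), ζ(5), …` then `E × E` contains all vectors of
Theorem 1": the `ℚ`-span of the vectors of Theorem 1 lies in `E × E` for `E = Span_ℚ(1, ζ(3), …, ζ(a+2))`, so its
rank is at most `2 dim E`. [cite: Fischler2015Vectors, §1 (paragraph after Theorem 1)] -/
theorem finrank_pairs_le (a : ℕ) :
    Module.finrank ℚ
        ↥(Submodule.span ℚ
          ({((1 : ℝ), (0 : ℝ)), ((0 : ℝ), (1 : ℝ))} ∪
            {v : ℝ × ℝ | ∃ i : ℕ, Odd i ∧ 3 ≤ i ∧ i ≤ a ∧ v = zetaPair i})) ≤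
      2 * Module.finrank ℚ
        ↥(Submodule.span ℚ (insert (1 : ℝ) {x | ∃ k : ℕ, Odd k ∧ 3 ≤ k ∧ k ≤ a + 2 ∧ x = zetaValue k})) := by
  set E : Submodule ℚ ℝ :=
    Submodule.span ℚ (insert (1 : ℝ) {x | ∃ k : ℕ, Odd k ∧ 3 ≤ k ∧ k ≤ a + 2 ∧ x = zetaValue k}) with hE
  -- `E` is finite-dimensional (finitely many generators)
  have hfinset : (insert (1 : ℝ) {x | ∃ k : ℕ, Odd k ∧ 3 ≤ k ∧ k ≤ a + 2 ∧ x = zetaValue k}).Finite := by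
    refine Set.Finite.insert _ ?_
    refine ((Set.finite_Icc 3 (a + 2)).image zetaValue).subset ?_
    rintro x ⟨k, -, hk3, hka, rfl⟩
    exact ⟨k, ⟨hk3, hka⟩, rfl⟩
  haveI : FiniteDimensional ℚ ↥E := FiniteDimensional.span_of_finite ℚ hfinset
  have h1E : (1 : ℝ) ∈ E := Submodule.subset_span (Set.mem_insert _ _)
  have hzE : ∀ k : ℕ, Odd k → 3 ≤ k → k ≤ a + 2 → zetaValue k ∈ E := fun k hk h3 hka =>
    Submodule.subset_span (Set.mem_insert_of_mem _ ⟨k, hk, h3, hka, rfl⟩)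
  -- the pair span lies in `E × E`
  have hle : Submodule.span ℚ ({((1 : ℝ), (0 : ℝ)), ((0 : ℝ), (1 : ℝ))} ∪
      {v : ℝ × ℝ | ∃ i : ℕ, Odd i ∧ 3 ≤ i ∧ i ≤ a ∧ v = zetaPair i}) ≤ E.prod E := by
    refine Submodule.span_le.mpr ?_
    rintro v (hv | ⟨i, hi, hi3, hia, rfl⟩)
    · rcases hv with rfl | rfl
      · exact ⟨h1E, E.zero_mem⟩
      · exact ⟨E.zero_mem, h1E⟩
    · refine ⟨hzE i hi hi3 (by omega), ?_⟩
      have hmem := hzE (i + 2) (by obtain ⟨r, hr⟩ := hi; exact ⟨r + 1, by omega⟩) (by omega) (by omega)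
      have : ((Nat.choose (i + 1) 2 : ℝ) * zetaValue (i + 2)) = (Nat.choose (i + 1) 2 : ℚ) • zetaValue (i + 2) := by
        rw [Rat.smul_def]; push_cast; ring
      change (Nat.choose (i + 1) 2 : ℝ) * zetaValue (i + 2) ∈ E
      rw [this]
      exact E.smul_mem _ hmem
  -- `E.prod E ≃ E × E`, so it is finite-dimensional of dimension `2 dim E`
  let e : ↥(E.prod E) ≃ₗ[ℚ] ↥E × ↥E :=
    { toFun := fun x => (⟨x.1.1, (Submodule.mem_prod.mp x.2).1⟩, ⟨x.1.2, (Submodule.mem_prod.mp x.2).2⟩)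
      map_add' := fun _ _ => rfl
      map_smul' := fun _ _ => rfl
      invFun := fun y => ⟨(y.1.1, y.2.1), Submodule.mem_prod.mpr ⟨y.1.2, y.2.2⟩⟩
      left_inv := fun _ => rfl
      right_inv := fun _ => rfl }
  haveI : Module.Finite ℚ ↥(E.prod E) := Module.Finite.equiv e.symm
  calc Module.finrank ℚ ↥(Submodule.span ℚ ({((1 : ℝ), (0 : ℝ)), ((0 : ℝ), (1 : ℝ))} ∪
          {v : ℝ × ℝ | ∃ i : ℕ, Odd i ∧ 3 ≤ i ∧ i ≤ a ∧ v = zetaPair i}))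
        ≤ Module.finrank ℚ ↥(E.prod E) := Submodule.finrank_mono hle
    _ = 2 * Module.finrank ℚ ↥E := by rw [LinearEquiv.finrank_eq e, Module.finrank_prod]; ring

/-- Hence Theorem 1 implies Ball–Rivoal's bound (1.1) (`dim_ℚ Span_ℚ(1, ζ(3), …, ζ(a)) ≥ (log a/(1+log 2))(1+o(1))`,
tree: `Literature.NumberTheory.Transcendental.ball_rivoal`, PROVED there as `ball_rivoal_holds`), here in the form read
off directly from `finrank_pairs_le`: `dim_ℚ Span_ℚ(1, ζ(3), …, ζ(a+2)) ≥ (1 − ε) log a/(1 + log 2)` for all large odd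
`a`. [cite: Fischler2015Vectors, §1 ("It is clear that Theorem 1 implies Eq. (1.1)")] -/
theorem theorem1.span_lower_bound (h : theorem1) :
    ∀ ε : ℝ, 0 < ε → ∀ᶠ a : ℕ in atTop, Odd a →
      (1 - ε) * (Real.log a / (1 + Real.log 2)) ≤
        Module.finrank ℚ
          ↥(Submodule.span ℚ (insert (1 : ℝ) {x | ∃ k : ℕ, Odd k ∧ 3 ≤ k ∧ k ≤ a + 2 ∧ x = zetaValue k})) := by
  intro ε hε
  filter_upwards [h ε hε] with a ha hodd
  have h1 := ha hodd
  have h2 : (Module.finrank ℚ ↥(Submodule.span ℚ ({((1 : ℝ), (0 : ℝ)), ((0 : ℝ), (1 : ℝ))} ∪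
      {v : ℝ × ℝ | ∃ i : ℕ, Odd i ∧ 3 ≤ i ∧ i ≤ a ∧ v = zetaPair i})) : ℝ) ≤
        2 * (Module.finrank ℚ ↥(Submodule.span ℚ
          (insert (1 : ℝ) {x | ∃ k : ℕ, Odd k ∧ 3 ≤ k ∧ k ≤ a + 2 ∧ x = zetaValue k})) : ℝ) := by
    exact_mod_cast finrank_pairs_le a
  have h3 : (1 - ε) * (2 * Real.log a / (1 + Real.log 2)) =
      2 * ((1 - ε) * (Real.log a / (1 + Real.log 2))) := by ring
  rw [h3] at h1
  linarith

end Literature.NumberTheory.Irrationality.Fischler2015
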